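import Literature.NumberTheory.Sieve.VinogradovExpSum
import Literature.NumberTheory.LFunctions.LiouvilleSumClassicalBound
import Mathlib.NumberTheory.DiophantineApproximation.Basic
import HarnessLib

/-!
# Minor-arc bounds for exponential sums over the Möbius and Liouville functions
# (Davenport–Vinogradov–Vaughan; Green 2012, Proposition 4), proved

Topic `Literature/NumberTheory/LFunctions`. Everything in this file is PROVED (theorems only); it
is the "Type I / Type II" input of the proof of the named fact
`Literature.NumberTheory.LFunctions.green_liouville_fourierWalsh` (Green 2012, Proposition 1 for
`λ`, `MoebiusWalshCircuits.lean`).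

B. Green, *On (not) computing the Möbius function using bounded depth circuits*, Combin. Probab.
Comput. 21 (2012), §4, Proposition 4: "Suppose that `|μ̂(θ)| ≥ δ`. Then there is some
`q ≪ (log N/δ)^{16}` such that `|θ - a/q| ≪ (log N/δ)^{16} N^{-1}`", with the printed proof
sketch "by Dirichlet's theorem … we may apply [Iwaniec–Kowalski, Thm 13.9]
`δ (log N)^{-4} ≪ max(q^{1/4}N^{-1/4}, q^{-1/4}, N^{-1/10})` …". We prove the underlying
Vinogradov-type bound for `∑_{n ≤ N} μ(n) e(nα)` from scratch with Vaughan's method, in the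
explicit form (`MoebiusExpSum.norm_afExpSum_moebius_le`)

  `|∑_{n ≤ N} μ(n) e(nα)| ≤ C (N/√q + N^{9/10} + √N √q) (log N)⁴`
  (`N ≥ 3`, `1 ≤ q ≤ N`, `(a, q) = 1`, `|α - a/q| ≤ q⁻²`),

deduce Green's Proposition 4 for `μ` (`MoebiusExpSum.moebius_minorArc`, exponent `20` in place
of `16`, which is immaterial downstream) and, through `λ = 𝟙_□ ⋆ μ`
(`LiouvilleSum.coe_liouville_eq_zeta_mul_liouville_mul_moebius`), the same statement for the
Liouville function (`MoebiusExpSum.liouville_minorArc`), which is the form used for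
Proposition 1 for `λ` ("All of the results in this paper hold equally well for the Liouville
function, with very similar proofs", Green §1).

## The argument (Vaughan's identity for `μ`, cf. Iwaniec–Kowalski §13.4–13.5)

With `M = μ·𝟙_{≤U}` (`Sieve.moebiusTrunc`) and `G_U = (μ - M) ⋆ ζ` (`Sieve.Vaughan.gU`,
`G_U(k) = ∑_{e∣k, e>U} μ(e)`, `|G_U| ≤ τ`, `G_U = 0` on `[1,U]`), Möbius inversion `μ ⋆ ζ = δ` gives
the identity (`MoebiusExpSum.moebius_eq_three_terms`)

  `μ = 2M - (M ⋆ M) ⋆ ζ + G_U ⋆ (μ - M)`.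

Summed against `e(nα)` (`Sieve.Vinogradov.afExpSum_mul`): the first term is `≤ 2U`; the second is
a TYPE I sum `∑_{k ≤ U²} (M⋆M)(k) ∑_{m ≤ N/k} e(αkm)` with `|(M⋆M)(k)| ≤ τ(k)`, bounded by
Cauchy–Schwarz, `∑_{k ≤ x} τ(k)²/k ≤ 2(1 + log x)⁴` (partial summation of the tree's
`Sieve.Vaughan.sum_sq_card_divisors_le`) and Vinogradov's Lemma 4.10
(`Sieve.Vinogradov.sum_geomBound_div_le`); the third is a TYPE II sum handled exactly as the sum
`S₄` of `Sieve/VinogradovExpSum.lean` (dyadic blocks, Cauchy–Schwarz, the tree's mean square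
`Sieve.Vinogradov.typeII_sum_norm_sq_le`), with `F_U = Λ - Λ_U` replaced by `μ - M` (`|μ - M| ≤ 1`).
The choice `U = ⌊N^{2/5}⌋` gives the saving `N^{-1/10} (log N)⁴`. Proposition 4 follows by
Dirichlet's approximation theorem (Mathlib's `Real.exists_rat_abs_sub_le_and_den_le`).

## References

* B. Green, Combin. Probab. Comput. 21 (2012) 942–951, §4, Proposition 4 [Green2012].
* H. Iwaniec, E. Kowalski, *Analytic Number Theory*, AMS Coll. Publ. 53 (2004), §13.4–13.5,
  Theorem 13.9 (the bound Green quotes).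
* M. B. Nathanson, *Additive Number Theory: the Classical Bases*, GTM 164, §8.5 (Vaughan's
  method, as formalised in `Sieve/VinogradovExpSum.lean`) [Nathanson1996].
-/

noncomputable section

open Finset Real ArithmeticFunction
open scoped FourierTransform ArithmeticFunction.Moebius ArithmeticFunction.zeta
  ArithmeticFunction.sigma

namespace Literature.NumberTheory.LFunctions

namespace MoebiusExpSum

open Literature.NumberTheory.Sieve (moebiusTrunc moebiusTrunc_apply)
open Literature.NumberTheory.Sieve.Vinogradov
open Literature.NumberTheory.Sieve.Vaughan (gU gU_apply gU_eq_zero_of_le abs_gU_le arith_sub_apply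
  sum_sq_card_divisors_le sum_Ioc_mul_two_pow_eq_sum abs_moebiusTrunc_le_one)

/-! ### Vaughan's identity for `μ` -/

/-- `μ - μ_{≤U}`: the Möbius function restricted to `n > U` (the Type II coefficient). [folklore] -/
def moebiusTail (U : ℕ) : ArithmeticFunction ℝ :=
  (μ : ArithmeticFunction ℝ) - (moebiusTrunc U : ArithmeticFunction ℝ)

/-- `(μ - μ_{≤U})(n) = μ(n)` for `n > U` and `0` otherwise. [folklore] -/
theorem moebiusTail_apply (U n : ℕ) :
    moebiusTail U n = if n ≤ U then 0 else (μ n : ℝ) := by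
  rw [moebiusTail, arith_sub_apply, intCoe_apply, intCoe_apply, moebiusTrunc_apply]
  split_ifs <;> simp

/-- `|(μ - μ_{≤U})(n)| ≤ 1`. [folklore] -/
theorem abs_moebiusTail_le_one (U n : ℕ) : |moebiusTail U n| ≤ 1 := by
  rw [moebiusTail_apply]
  split_ifs
  · simp
  · exact_mod_cast abs_moebius_le_one

/-- **Vaughan's identity for the Möbius function**: with `M = μ_{≤U}` and `G_U = (μ - M) ⋆ ζ`,
`μ = 2M - (M ⋆ M) ⋆ ζ + G_U ⋆ (μ - M)` (from `μ ⋆ ζ = δ`; cf. Iwaniec–Kowalski (13.38)).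
[folklore] -/
theorem moebius_eq_three_terms (U : ℕ) :
    (μ : ArithmeticFunction ℝ) =
      ((moebiusTrunc U : ArithmeticFunction ℝ) + (moebiusTrunc U : ArithmeticFunction ℝ)) -
        (moebiusTrunc U : ArithmeticFunction ℝ) * (moebiusTrunc U : ArithmeticFunction ℝ) *
          (ζ : ArithmeticFunction ℝ) +
        gU U * moebiusTail U := by
  have h : (μ : ArithmeticFunction ℝ) * (ζ : ArithmeticFunction ℝ) = 1 := coe_moebius_mul_coe_zeta
  rw [gU, moebiusTail]
  linear_combination (2 * (moebiusTrunc U : ArithmeticFunction ℝ) - (μ : ArithmeticFunction ℝ)) * h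

/-- Vaughan's identity summed against `e(nα)`:
`∑_{n≤N} μ(n)e(nα) = 2 ∑ M(n)e(nα) - ∑ ((M⋆M)⋆ζ)(n)e(nα) + ∑ (G_U ⋆ (μ-M))(n)e(nα)`. [folklore] -/
theorem afExpSum_moebius_eq (U N : ℕ) (α : ℝ) :
    afExpSum (⇑(μ : ArithmeticFunction ℝ)) N α =
      2 * afExpSum (⇑(moebiusTrunc U : ArithmeticFunction ℝ)) N α -
        afExpSum (⇑((moebiusTrunc U : ArithmeticFunction ℝ) * (moebiusTrunc U : ArithmeticFunction ℝ) *
          (ζ : ArithmeticFunction ℝ))) N α +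
        afExpSum (⇑(gU U * moebiusTail U)) N α := by
  have hV := moebius_eq_three_terms U
  unfold afExpSum
  rw [Finset.mul_sum, ← Finset.sum_sub_distrib, ← Finset.sum_add_distrib]
  refine Finset.sum_congr rfl fun n _ => ?_
  have h := congrArg (fun F : ArithmeticFunction ℝ => F n) hV
  simp only [ArithmeticFunction.add_apply, arith_sub_apply] at h
  rw [h]
  push_cast
  ring

/-- The trivial piece: `‖∑_{n ≤ N} μ_{≤U}(n) e(nα)‖ ≤ U`. [folklore] -/
theorem norm_afExpSum_moebiusTrunc_le (U N : ℕ) (α : ℝ) :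
    ‖afExpSum (⇑(moebiusTrunc U : ArithmeticFunction ℝ)) N α‖ ≤ U := by
  refine (norm_afExpSum_le _ N α).trans ?_
  have h1 : ∀ n ∈ Icc 1 N, |((moebiusTrunc U : ArithmeticFunction ℝ)) n| ≤ if n ≤ U then 1 else 0 :=
    fun n _ => abs_moebiusTrunc_le U n
  refine (Finset.sum_le_sum h1).trans ?_
  rw [← Finset.sum_filter]
  calc ∑ n ∈ (Icc 1 N).filter (fun n => n ≤ U), (1 : ℝ)
      = (((Icc 1 N).filter (fun n => n ≤ U)).card : ℝ) := by simp
    _ ≤ ((Icc 1 U).card : ℝ) := by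
        exact_mod_cast Finset.card_le_card (fun n hn => by
          simp only [Finset.mem_filter, Finset.mem_Icc] at hn ⊢; omega)
    _ = U := by simp

/-! ### The Type I sum `∑_{k ≤ U²} (M ⋆ M)(k) ∑_{m ≤ N/k} e(αkm)` -/

/-- **Partial summation identity**: with `A(k) = ∑_{j ≤ k} a_j`,
`∑_{k ≤ K} a_k/k = A(K)/(K+1) + ∑_{k ≤ K} A(k)/(k(k+1))`. [folklore] -/
theorem sum_div_eq_abel (a : ℕ → ℝ) (K : ℕ) :
    ∑ k ∈ Ioc 0 K, a k / k =
      (∑ j ∈ Ioc 0 K, a j) / ((K : ℝ) + 1) +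
        ∑ k ∈ Ioc 0 K, (∑ j ∈ Ioc 0 k, a j) / ((k : ℝ) * ((k : ℝ) + 1)) := by
  induction K with
  | zero => simp
  | succ K ih =>
    rw [Finset.sum_Ioc_succ_top (Nat.zero_le K), Finset.sum_Ioc_succ_top (Nat.zero_le K),
      Finset.sum_Ioc_succ_top (Nat.zero_le K) (fun k => (∑ j ∈ Ioc 0 k, a j) / ((k : ℝ) * ((k : ℝ) + 1))),
      ih, Finset.sum_Ioc_succ_top (Nat.zero_le K)]
    have hK1 : (K : ℝ) + 1 ≠ 0 := by positivity
    have hK2 : (K : ℝ) + 1 + 1 ≠ 0 := by positivity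
    push_cast
    field_simp
    ring

/-- **`∑_{k ≤ K} τ(k)²/k ≤ 2 (1 + log K)⁴`** (partial summation of the tree's
`Sieve.Vaughan.sum_sq_card_divisors_le`: `∑_{k ≤ x} τ(k)² ≤ x(1 + log x)³`). [folklore] -/
theorem sum_sq_card_divisors_div_le (K : ℕ) :
    ∑ k ∈ Ioc 0 K, ((k.divisors.card : ℕ) : ℝ) ^ 2 / k ≤ 2 * (1 + Real.log K) ^ 4 := by
  rcases Nat.eq_zero_or_pos K with rfl | hK
  · simp
  have hK1 : (1 : ℝ) ≤ K := by exact_mod_cast hK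
  have hlogK : 0 ≤ Real.log K := Real.log_nonneg hK1
  set B : ℝ := 1 + Real.log K with hB
  have hB1 : 1 ≤ B := by rw [hB]; linarith
  rw [sum_div_eq_abel]
  -- the boundary term
  have hA : ∀ k ∈ Ioc 0 K, ∑ j ∈ Ioc 0 k, ((j.divisors.card : ℕ) : ℝ) ^ 2 ≤ k * B ^ 3 := by
    intro k hk
    have hk1 : (1 : ℝ) ≤ k := by exact_mod_cast (Finset.mem_Ioc.mp hk).1
    have hkK : (k : ℝ) ≤ K := by exact_mod_cast (Finset.mem_Ioc.mp hk).2
    refine (sum_sq_card_divisors_le k).trans ?_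
    have hlogk : Real.log k ≤ Real.log K := Real.log_le_log (by linarith) hkK
    have h0 : 0 ≤ 1 + Real.log k := by have := Real.log_nonneg hk1; linarith
    have : (1 + Real.log k) ^ 3 ≤ B ^ 3 := pow_le_pow_left₀ h0 (by rw [hB]; linarith) 3
    exact mul_le_mul_of_nonneg_left this (by linarith)
  have h1 : (∑ j ∈ Ioc 0 K, ((j.divisors.card : ℕ) : ℝ) ^ 2) / ((K : ℝ) + 1) ≤ B ^ 4 := by
    rw [div_le_iff₀ (by positivity)]
    calc ∑ j ∈ Ioc 0 K, ((j.divisors.card : ℕ) : ℝ) ^ 2 ≤ K * B ^ 3 :=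
          hA K (Finset.mem_Ioc.mpr ⟨hK, le_rfl⟩)
      _ ≤ ((K : ℝ) + 1) * B ^ 3 := by gcongr; linarith
      _ ≤ ((K : ℝ) + 1) * B ^ 4 := by
          refine mul_le_mul_of_nonneg_left ?_ (by positivity)
          calc B ^ 3 = B ^ 3 * 1 := (mul_one _).symm
            _ ≤ B ^ 3 * B := mul_le_mul_of_nonneg_left hB1 (by positivity)
            _ = B ^ 4 := by ring
      _ = B ^ 4 * ((K : ℝ) + 1) := by ring
  have h2 : ∑ k ∈ Ioc 0 K, (∑ j ∈ Ioc 0 k, ((j.divisors.card : ℕ) : ℝ) ^ 2) / ((k : ℝ) * ((k : ℝ) + 1))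
      ≤ B ^ 4 := by
    calc ∑ k ∈ Ioc 0 K, (∑ j ∈ Ioc 0 k, ((j.divisors.card : ℕ) : ℝ) ^ 2) / ((k : ℝ) * ((k : ℝ) + 1))
        ≤ ∑ k ∈ Ioc 0 K, B ^ 3 * (k : ℝ)⁻¹ := Finset.sum_le_sum fun k hk => by
          have hk0 : (0 : ℝ) < k := by exact_mod_cast (Finset.mem_Ioc.mp hk).1
          rw [div_le_iff₀ (by positivity)]
          calc ∑ j ∈ Ioc 0 k, ((j.divisors.card : ℕ) : ℝ) ^ 2 ≤ k * B ^ 3 := hA k hk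
            _ ≤ k * B ^ 3 + B ^ 3 := by linarith [pow_nonneg (by linarith : (0 : ℝ) ≤ B) 3]
            _ = B ^ 3 * (k : ℝ)⁻¹ * ((k : ℝ) * ((k : ℝ) + 1)) := by field_simp
      _ = B ^ 3 * ∑ k ∈ Ioc 0 K, (k : ℝ)⁻¹ := by rw [Finset.mul_sum]
      _ ≤ B ^ 3 * B := mul_le_mul_of_nonneg_left
          (Literature.NumberTheory.Sieve.Vaughan.sum_Ioc_inv_le K) (by positivity)
      _ = B ^ 4 := by ring
  linarith

/-- `|(M ⋆ M)(k)| ≤ τ(k)`, and `(M ⋆ M)(k) = 0` for `k > U²` (`M = μ_{≤U}`). [folklore] -/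
theorem abs_moebiusTrunc_mul_le (U k : ℕ) :
    |((moebiusTrunc U : ArithmeticFunction ℝ) * (moebiusTrunc U : ArithmeticFunction ℝ)) k| ≤
      if k ≤ U * U then ((k.divisors.card : ℕ) : ℝ) else 0 := by
  rw [ArithmeticFunction.mul_apply]
  split_ifs with hk
  · refine (Finset.abs_sum_le_sum_abs _ _).trans ?_
    calc ∑ x ∈ k.divisorsAntidiagonal, |((moebiusTrunc U : ArithmeticFunction ℝ)) x.1 *
            ((moebiusTrunc U : ArithmeticFunction ℝ)) x.2|
        ≤ ∑ _x ∈ k.divisorsAntidiagonal, (1 : ℝ) := Finset.sum_le_sum fun x _ => by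
          rw [abs_mul]
          calc _ ≤ (1 : ℝ) * 1 := mul_le_mul (abs_moebiusTrunc_le_one U x.1)
                (abs_moebiusTrunc_le_one U x.2) (abs_nonneg _) zero_le_one
            _ = 1 := one_mul _
      _ = ((k.divisors.card : ℕ) : ℝ) := by
          rw [Finset.sum_const, nsmul_eq_mul, mul_one, ← Nat.map_div_right_divisors, Finset.card_map]
  · rw [Finset.sum_eq_zero, abs_zero]
    intro x hx
    have hk' : U * U < k := not_le.mp hk
    have hprod : x.1 * x.2 = k := (Nat.mem_divisorsAntidiagonal.mp hx).1
    rw [intCoe_apply, intCoe_apply, moebiusTrunc_apply, moebiusTrunc_apply]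
    by_cases h1 : x.1 ≤ U
    · by_cases h2 : x.2 ≤ U
      · exfalso
        have : x.1 * x.2 ≤ U * U := Nat.mul_le_mul h1 h2
        omega
      · rw [if_neg h2]; simp
    · rw [if_neg h1]; simp

/-- `(a + b + c)² ≥ a² + b² + c²` for nonnegative reals. [folklore] -/
theorem sq_add_sq_add_sq_le {a b c : ℝ} (ha : 0 ≤ a) (hb : 0 ≤ b) (hc : 0 ≤ c) :
    a ^ 2 + b ^ 2 + c ^ 2 ≤ (a + b + c) ^ 2 := by
  nlinarith [mul_nonneg ha hb, mul_nonneg ha hc, mul_nonneg hb hc]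

/-- **The Type I bound**: for `|α - a/q| ≤ q⁻²`, `(a, q) = 1`, `1 ≤ q ≤ N`, `N ≥ 3`, `1 ≤ U`,
`U² ≤ N`, `‖∑_{n ≤ N} ((M⋆M)⋆ζ)(n) e(nα)‖ ≤ 20 (log N)³ (N/√q + √N·U + √N √q)`
(Cauchy–Schwarz with `∑ τ(k)²/k ≤ 2(1+log)⁴` and Vinogradov's Lemma 4.10). [folklore] -/
theorem norm_typeI_le {α : ℝ} {a : ℤ} {q : ℕ} (hq : 1 ≤ q) (hcop : IsCoprime a q)
    (hα : |α - a / q| ≤ 1 / (q : ℝ) ^ 2) {N U : ℕ} (hN : 3 ≤ N) (hqN : q ≤ N) (hU : 1 ≤ U)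
    (hUN : U * U ≤ N) :
    ‖afExpSum (⇑((moebiusTrunc U : ArithmeticFunction ℝ) * (moebiusTrunc U : ArithmeticFunction ℝ) *
        (ζ : ArithmeticFunction ℝ))) N α‖ ≤
      20 * Real.log N ^ 3 * (N / Real.sqrt q + Real.sqrt N * U + Real.sqrt N * Real.sqrt q) := by
  have hN0 : (0 : ℝ) < N := by exact_mod_cast (by omega : 0 < N)
  have hN0' : (0 : ℝ) ≤ N := hN0.le
  have hq0 : (0 : ℝ) < q := by exact_mod_cast hq
  have hU0 : (0 : ℝ) < U := by exact_mod_cast hU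
  have hUU : 1 ≤ U * U := Nat.mul_le_mul hU hU
  have hlogN1 : 1 ≤ Real.log N := by
    rw [← Real.log_exp 1]
    refine Real.log_le_log (Real.exp_pos 1) ?_
    have := Real.exp_one_lt_d9
    have h3 : (3 : ℝ) ≤ N := by exact_mod_cast hN
    linarith
  set L := Real.log N with hL
  -- Step 1: reduce to `∑_{k ≤ U²} τ(k) geomBound(N/k, αk)`
  have step1 : ‖afExpSum (⇑((moebiusTrunc U : ArithmeticFunction ℝ) *
      (moebiusTrunc U : ArithmeticFunction ℝ) * (ζ : ArithmeticFunction ℝ))) N α‖ ≤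
      ∑ k ∈ Icc 1 (U * U), ((k.divisors.card : ℕ) : ℝ) * geomBound (N / k) (α * k) := by
    rw [afExpSum_mul]
    refine (norm_sum_le _ _).trans ?_
    have hterm : ∀ k ∈ Icc 1 N,
        ‖((((moebiusTrunc U : ArithmeticFunction ℝ) * (moebiusTrunc U : ArithmeticFunction ℝ)) k : ℝ) : ℂ) *
          ∑ m ∈ Icc 1 (N / k), ((ζ : ArithmeticFunction ℝ) m : ℂ) * (𝐞 ((m : ℝ) * (α * k)) : ℂ)‖ ≤
          (if k ≤ U * U then ((k.divisors.card : ℕ) : ℝ) else 0) * geomBound (N / k) (α * k) := by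
      intro k hk
      rw [norm_mul, Complex.norm_real, Real.norm_eq_abs]
      have hin : ∑ m ∈ Icc 1 (N / k), ((ζ : ArithmeticFunction ℝ) m : ℂ) *
          (𝐞 ((m : ℝ) * (α * k)) : ℂ) = ∑ m ∈ Icc 1 (N / k), (𝐞 ((m : ℝ) * (α * k)) : ℂ) := by
        refine Finset.sum_congr rfl fun m hm => ?_
        have hm1 : m ≠ 0 := by have := (Finset.mem_Icc.mp hm).1; omega
        rw [ArithmeticFunction.natCoe_apply, ArithmeticFunction.zeta_apply_ne hm1]
        simp
      rw [hin]
      have hgeo : ‖∑ m ∈ Icc 1 (N / k), (𝐞 ((m : ℝ) * (α * k)) : ℂ)‖ ≤ geomBound (N / k) (α * k) :=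
        norm_sum_Icc_fourierChar_le_geomBound _ Nat.cast_div_le
      have hG : 0 ≤ geomBound ((N : ℝ) / k) (α * k) := geomBound_nonneg (by positivity) _
      exact mul_le_mul (abs_moebiusTrunc_mul_le U k) hgeo (norm_nonneg _) (by positivity)
    refine (Finset.sum_le_sum hterm).trans ?_
    simp only [ite_mul, zero_mul]
    rw [← Finset.sum_filter, show (Icc 1 N).filter (fun k => k ≤ U * U) = Icc 1 (U * U) by
      ext k; simp only [Finset.mem_filter, Finset.mem_Icc]; omega]
  -- Step 2: Cauchy–Schwarz
  have hCS := Finset.sum_mul_sq_le_sq_mul_sq (Icc 1 (U * U))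
    (fun k => ((k.divisors.card : ℕ) : ℝ) / Real.sqrt k) (fun k => Real.sqrt k * geomBound (N / k) (α * k))
  have hfg : ∀ k ∈ Icc 1 (U * U), ((k.divisors.card : ℕ) : ℝ) / Real.sqrt k *
      (Real.sqrt k * geomBound (N / k) (α * k)) = ((k.divisors.card : ℕ) : ℝ) * geomBound (N / k) (α * k) := by
    intro k hk
    have hk0 : (0 : ℝ) < k := by exact_mod_cast (Finset.mem_Icc.mp hk).1
    have hs : Real.sqrt k ≠ 0 := (Real.sqrt_pos.mpr hk0).ne'
    field_simp
  rw [Finset.sum_congr rfl hfg] at hCS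
  have hf2 : ∑ k ∈ Icc 1 (U * U), (((k.divisors.card : ℕ) : ℝ) / Real.sqrt k) ^ 2 ≤ 2 * (1 + Real.log (U * U : ℕ)) ^ 4 := by
    have := sum_sq_card_divisors_div_le (U * U)
    rw [Literature.NumberTheory.Sieve.Vaughan.Ioc_zero_eq_Icc_one] at this
    refine le_trans (le_of_eq (Finset.sum_congr rfl fun k hk => ?_)) this
    have hk0 : (0 : ℝ) < k := by exact_mod_cast (Finset.mem_Icc.mp hk).1
    rw [div_pow, Real.sq_sqrt hk0.le]
  have hg2 : ∑ k ∈ Icc 1 (U * U), (Real.sqrt k * geomBound (N / k) (α * k)) ^ 2 ≤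
      N * (4 * (N / q + (U * U : ℕ) + q) * (1 + Real.log (q * (U * U : ℕ)))) := by
    have hL := sum_geomBound_div_le hq hcop hα hN0' hUU
    calc ∑ k ∈ Icc 1 (U * U), (Real.sqrt k * geomBound (N / k) (α * k)) ^ 2
        ≤ ∑ k ∈ Icc 1 (U * U), N * geomBound (N / k) (α * k) := Finset.sum_le_sum fun k hk => by
          have hk0 : (0 : ℝ) < k := by exact_mod_cast (Finset.mem_Icc.mp hk).1
          have hG : 0 ≤ geomBound ((N : ℝ) / k) (α * k) := geomBound_nonneg (by positivity) _
          have hGle : geomBound ((N : ℝ) / k) (α * k) ≤ N / k := geomBound_le _ _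
          rw [mul_pow, Real.sq_sqrt hk0.le]
          calc (k : ℝ) * geomBound (N / k) (α * k) ^ 2
              = (k * geomBound (N / k) (α * k)) * geomBound (N / k) (α * k) := by ring
            _ ≤ (k * (N / k)) * geomBound (N / k) (α * k) :=
                mul_le_mul_of_nonneg_right (mul_le_mul_of_nonneg_left hGle hk0.le) hG
            _ = N * geomBound (N / k) (α * k) := by field_simp
      _ = N * ∑ k ∈ Icc 1 (U * U), geomBound (N / k) (α * k) := by rw [Finset.mul_sum]
      _ ≤ _ := mul_le_mul_of_nonneg_left hL hN0'
  -- Step 3: the logarithms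
  have hUUN : ((U * U : ℕ) : ℝ) ≤ N := by exact_mod_cast hUN
  have hqN' : (q : ℝ) ≤ N := by exact_mod_cast hqN
  have hlog1 : 1 + Real.log (U * U : ℕ) ≤ 2 * L := by
    have : Real.log (U * U : ℕ) ≤ L := Real.log_le_log (by exact_mod_cast hUU) hUUN
    linarith
  have hlog2 : 1 + Real.log (q * (U * U : ℕ)) ≤ 3 * L := by
    have : Real.log (q * (U * U : ℕ)) ≤ L + L := by
      rw [hL, ← Real.log_mul hN0.ne' hN0.ne']
      exact Real.log_le_log (by positivity) (mul_le_mul hqN' hUUN (by positivity) hN0')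
    linarith
  have hlog10 : 0 ≤ 1 + Real.log (U * U : ℕ) := by
    have := Real.log_nonneg (show (1 : ℝ) ≤ (U * U : ℕ) by exact_mod_cast hUU); linarith
  -- Step 4: combine
  set X : ℝ := N / Real.sqrt q + Real.sqrt N * U + Real.sqrt N * Real.sqrt q with hX
  have hX0 : 0 ≤ X := by positivity
  have hsq : (∑ k ∈ Icc 1 (U * U), ((k.divisors.card : ℕ) : ℝ) * geomBound (N / k) (α * k)) ^ 2 ≤
      (20 * L ^ 3 * X) ^ 2 := by
    refine hCS.trans ?_
    have hA : 2 * (1 + Real.log (U * U : ℕ)) ^ 4 ≤ 2 * (2 * L) ^ 4 := by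
      have := pow_le_pow_left₀ hlog10 hlog1 4; linarith
    have hB : (N : ℝ) * (4 * (N / q + (U * U : ℕ) + q) * (1 + Real.log (q * (U * U : ℕ)))) ≤
        N * (4 * (N / q + (U * U : ℕ) + q) * (3 * L)) := by
      refine mul_le_mul_of_nonneg_left (mul_le_mul_of_nonneg_left hlog2 (by positivity)) hN0'
    have hXsq : (N : ℝ) ^ 2 / q + N * (U * U : ℕ) + N * q ≤ X ^ 2 := by
      have e1 : ((N : ℝ) / Real.sqrt q) ^ 2 = (N : ℝ) ^ 2 / q := by rw [div_pow, Real.sq_sqrt hq0.le]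
      have e2 : (Real.sqrt N * U) ^ 2 = N * (U * U : ℕ) := by
        rw [mul_pow, Real.sq_sqrt hN0']; push_cast; ring
      have e3 : (Real.sqrt N * Real.sqrt q) ^ 2 = (N : ℝ) * q := by
        rw [mul_pow, Real.sq_sqrt hN0', Real.sq_sqrt hq0.le]
      rw [← e1, ← e2, ← e3, hX]
      exact sq_add_sq_add_sq_le (by positivity) (by positivity) (by positivity)
    have hL0 : 0 ≤ L := by linarith
    have hL5 : L ^ 5 ≤ L ^ 6 := by
      calc L ^ 5 = L ^ 5 * 1 := (mul_one _).symm
        _ ≤ L ^ 5 * L := mul_le_mul_of_nonneg_left hlogN1 (by positivity)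
        _ = L ^ 6 := by ring
    calc (∑ k ∈ Icc 1 (U * U), (((k.divisors.card : ℕ) : ℝ) / Real.sqrt k) ^ 2) *
          ∑ k ∈ Icc 1 (U * U), (Real.sqrt k * geomBound (N / k) (α * k)) ^ 2
        ≤ (2 * (2 * L) ^ 4) * (N * (4 * (N / q + (U * U : ℕ) + q) * (3 * L))) :=
          mul_le_mul (hf2.trans hA) (hg2.trans hB) (Finset.sum_nonneg fun _ _ => sq_nonneg _)
            (by positivity)
      _ = 384 * L ^ 5 * ((N : ℝ) ^ 2 / q + N * (U * U : ℕ) + N * q) := by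
          field_simp
          ring
      _ ≤ 384 * L ^ 6 * X ^ 2 := by
          have h1 : 0 ≤ (N : ℝ) ^ 2 / q + N * (U * U : ℕ) + N * q := by positivity
          calc 384 * L ^ 5 * ((N : ℝ) ^ 2 / q + N * (U * U : ℕ) + N * q)
              ≤ 384 * L ^ 6 * ((N : ℝ) ^ 2 / q + N * (U * U : ℕ) + N * q) := by
                gcongr
            _ ≤ 384 * L ^ 6 * X ^ 2 := by gcongr
      _ ≤ (20 * L ^ 3 * X) ^ 2 := by
          rw [show (20 * L ^ 3 * X) ^ 2 = 400 * L ^ 6 * X ^ 2 by ring]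
          gcongr; norm_num
  have hS0 : 0 ≤ ∑ k ∈ Icc 1 (U * U), ((k.divisors.card : ℕ) : ℝ) * geomBound (N / k) (α * k) :=
    Finset.sum_nonneg fun k _ => mul_nonneg (Nat.cast_nonneg _) (geomBound_nonneg (by positivity) _)
  have hY0 : 0 ≤ 20 * L ^ 3 * X := by positivity
  exact step1.trans ((pow_le_pow_iff_left₀ hS0 hY0 two_ne_zero).mp hsq)

/-! ### The Type II sum `∑_{k > U} G_U(k) ∑_{U < ℓ ≤ N/k} μ(ℓ) e(αkℓ)` -/

/-- `1 ≤ log N` for `N ≥ 3`. [folklore] -/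
theorem one_le_log_of_three_le {N : ℕ} (hN : 3 ≤ N) : 1 ≤ Real.log N := by
  rw [← Real.log_exp 1]
  refine Real.log_le_log (Real.exp_pos 1) ?_
  have := Real.exp_one_lt_d9
  have h3 : (3 : ℝ) ≤ N := by exact_mod_cast hN
  linarith

/-- `|(μ - μ_{≤U})(ℓ)| ≤ log N` for `N ≥ 3` (crudely, `1 ≤ log 3`). [folklore] -/
theorem abs_moebiusTail_le_log {U ℓ N : ℕ} (hN : 3 ≤ N) : |moebiusTail U ℓ| ≤ Real.log N :=
  (abs_moebiusTail_le_one U ℓ).trans (one_le_log_of_three_le hN)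

/-- **Cauchy–Schwarz on a dyadic block** of the Type II sum (as `Sieve.Vinogradov.typeII_block_le_sqrt`,
with `F_U` replaced by `μ - μ_{≤U}`): `|∑_{K<k≤2K} G_U(k) T(k)| ≤ (∑ τ(k)²)^{1/2} (∑ |T(k)|²)^{1/2}`
with the tree's divisor mean square and mean square `typeII_sum_norm_sq_le`.
[cite: Nathanson1996, §8.5, proof of Lemma 8.8] -/
theorem typeII_block_le_sqrt {α : ℝ} {a : ℤ} {q : ℕ} (hq : 1 ≤ q) (hcop : IsCoprime a q)
    (hα : |α - a / q| ≤ 1 / (q : ℝ) ^ 2) {N K : ℕ} (hN : 3 ≤ N) (hK : 1 ≤ K) (u : ℕ) :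
    ‖∑ k ∈ Ioc K (2 * K), (gU u k : ℂ) *
        ∑ ℓ ∈ Icc 1 (N / k), (moebiusTail u ℓ : ℂ) * (𝐞 ((ℓ : ℝ) * (α * k)) : ℂ)‖ ≤
      Real.sqrt (2 * K * (1 + Real.log (2 * K : ℕ)) ^ 3) *
        Real.sqrt (Real.log N ^ 2 *
          (N + 8 * ((N : ℝ) / K) * (N / q + N / K + q) * (1 + Real.log (q * N)))) := by
  set G : ℕ → ℝ := fun k => gU u k with hGdef
  set T : ℕ → ℂ := fun k => ∑ ℓ ∈ Icc 1 (N / k), (moebiusTail u ℓ : ℂ) * (𝐞 ((ℓ : ℝ) * (α * k)) : ℂ)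
    with hTdef
  show ‖∑ k ∈ Ioc K (2 * K), (G k : ℂ) * T k‖ ≤ _
  have h1 : ‖∑ k ∈ Ioc K (2 * K), (G k : ℂ) * T k‖ ≤ ∑ k ∈ Ioc K (2 * K), |G k| * ‖T k‖ := by
    refine (norm_sum_le _ _).trans (le_of_eq (Finset.sum_congr rfl fun k _ => ?_))
    rw [norm_mul, Complex.norm_real, Real.norm_eq_abs]
  have hCS := Finset.sum_mul_sq_le_sq_mul_sq (Ioc K (2 * K)) (fun k => |G k|) (fun k => ‖T k‖)
  have hA : ∑ k ∈ Ioc K (2 * K), |G k| ^ 2 ≤ 2 * K * (1 + Real.log (2 * K : ℕ)) ^ 3 := by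
    calc ∑ k ∈ Ioc K (2 * K), |G k| ^ 2
        ≤ ∑ k ∈ Ioc K (2 * K), ((k.divisors.card : ℕ) : ℝ) ^ 2 := by
          refine Finset.sum_le_sum fun k _ => pow_le_pow_left₀ (abs_nonneg _) ?_ 2
          have h := abs_gU_le u k
          rw [ArithmeticFunction.sigma_zero_apply] at h
          exact h
      _ ≤ ∑ k ∈ Ioc 0 (2 * K), ((k.divisors.card : ℕ) : ℝ) ^ 2 :=
          Finset.sum_le_sum_of_subset_of_nonneg (Finset.Ioc_subset_Ioc_left (Nat.zero_le K))
            fun _ _ _ => sq_nonneg _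
      _ ≤ ((2 * K : ℕ) : ℝ) * (1 + Real.log (2 * K : ℕ)) ^ 3 := sum_sq_card_divisors_le (2 * K)
      _ = 2 * K * (1 + Real.log (2 * K : ℕ)) ^ 3 := by push_cast; ring
  have hB : ∑ k ∈ Ioc K (2 * K), ‖T k‖ ^ 2 ≤ Real.log N ^ 2 *
      (N + 8 * ((N : ℝ) / K) * (N / q + N / K + q) * (1 + Real.log (q * N))) := by
    exact typeII_sum_norm_sq_le hq hcop hα hK (Real.log_natCast_nonneg N)
      fun ℓ _ => abs_moebiusTail_le_log hN
  have hS0 : 0 ≤ ∑ k ∈ Ioc K (2 * K), |G k| * ‖T k‖ :=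
    Finset.sum_nonneg fun k _ => mul_nonneg (abs_nonneg _) (norm_nonneg _)
  calc ‖∑ k ∈ Ioc K (2 * K), (G k : ℂ) * T k‖ ≤ ∑ k ∈ Ioc K (2 * K), |G k| * ‖T k‖ := h1
    _ = Real.sqrt ((∑ k ∈ Ioc K (2 * K), |G k| * ‖T k‖) ^ 2) := (Real.sqrt_sq hS0).symm
    _ ≤ Real.sqrt ((∑ k ∈ Ioc K (2 * K), |G k| ^ 2) * ∑ k ∈ Ioc K (2 * K), ‖T k‖ ^ 2) :=
        Real.sqrt_le_sqrt hCS
    _ ≤ Real.sqrt ((2 * K * (1 + Real.log (2 * K : ℕ)) ^ 3) * (Real.log N ^ 2 *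
          (N + 8 * ((N : ℝ) / K) * (N / q + N / K + q) * (1 + Real.log (q * N))))) := by
        refine Real.sqrt_le_sqrt (mul_le_mul hA hB (Finset.sum_nonneg fun _ _ => sq_nonneg _) ?_)
        positivity
    _ = _ := Real.sqrt_mul (by positivity) _

/-- **Uniform bound for a dyadic block** `u ≤ K ≤ N/u` of the Type II sum (as
`Sieve.Vinogradov.typeII_block_le`): `≤ 64 (log N)³ (N/√q + 2N/√u + √N √q)`.
[cite: Nathanson1996, §8.5, proof of Lemma 8.8] -/
theorem typeII_block_le {α : ℝ} {a : ℤ} {q : ℕ} (hq : 1 ≤ q) (hcop : IsCoprime a q)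
    (hα : |α - a / q| ≤ 1 / (q : ℝ) ^ 2) {N K u : ℕ} (hN : 3 ≤ N) (hqN : q ≤ N) (hu : 1 ≤ u)
    (huK : u ≤ K) (hKu : K * u ≤ N) :
    ‖∑ k ∈ Ioc K (2 * K), (gU u k : ℂ) *
        ∑ ℓ ∈ Icc 1 (N / k), (moebiusTail u ℓ : ℂ) * (𝐞 ((ℓ : ℝ) * (α * k)) : ℂ)‖ ≤
      64 * Real.log N ^ 3 * (N / Real.sqrt q + 2 * (N / Real.sqrt u) + Real.sqrt N * Real.sqrt q) := by
  have hK : 1 ≤ K := le_trans hu huK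
  have hN2 : 2 ≤ N := le_trans (by norm_num) hN
  refine (typeII_block_le_sqrt hq hcop hα hN hK u).trans ?_
  have hL2 : 1 / 2 < Real.log N := half_lt_log hN2
  have hlog2' := Real.log_two_gt_d9
  have hN0 : (0 : ℝ) < N := by exact_mod_cast (lt_of_lt_of_le (by norm_num) hN)
  have hN1 : (1 : ℝ) ≤ N := by exact_mod_cast (le_trans (by norm_num) hN)
  have hq0 : (0 : ℝ) < q := by exact_mod_cast hq
  have hq1 : (1 : ℝ) ≤ q := by exact_mod_cast hq
  have hK0 : (0 : ℝ) < K := by exact_mod_cast hK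
  have hu0 : (0 : ℝ) < u := by exact_mod_cast hu
  have hKN : (K : ℝ) ≤ N / u := by
    rw [le_div_iff₀ hu0]; exact_mod_cast hKu
  have huK' : (u : ℝ) ≤ K := by exact_mod_cast huK
  have hlog2K : 1 + Real.log (2 * K : ℕ) ≤ 4 * Real.log N := by
    have hKN' : (K : ℝ) ≤ N := le_trans hKN (div_le_self hN0.le (by exact_mod_cast hu))
    have h1 : Real.log (2 * K : ℕ) ≤ Real.log 2 + Real.log N := by
      rw [← Real.log_mul (by norm_num) hN0.ne']
      exact Real.log_le_log (by positivity) (by push_cast; linarith)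
    have hlogN2 : Real.log 2 ≤ Real.log N := Real.log_le_log (by norm_num) (by exact_mod_cast hN2)
    linarith
  have hlog2K0 : 0 ≤ 1 + Real.log (2 * K : ℕ) := by
    have := Real.log_natCast_nonneg (2 * K); linarith
  have hlogqN : 1 + Real.log (q * N) ≤ 4 * Real.log N := by
    have h1 : Real.log (q * N) ≤ Real.log N + Real.log N := by
      rw [← Real.log_mul hN0.ne' hN0.ne']
      exact Real.log_le_log (by positivity)
        (mul_le_mul_of_nonneg_right (by exact_mod_cast hqN) hN0.le)
    linarith
  have hlogqN0 : 0 ≤ 1 + Real.log (q * N) := by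
    have := Real.log_nonneg (one_le_mul_of_one_le_of_one_le hq1 hN1); linarith
  have hP2 : ((N : ℝ) / Real.sqrt q) ^ 2 = (N : ℝ) ^ 2 / q := by
    rw [div_pow, Real.sq_sqrt hq0.le]
  have hQ2 : ((N : ℝ) / Real.sqrt u) ^ 2 = (N : ℝ) ^ 2 / u := by
    rw [div_pow, Real.sq_sqrt hu0.le]
  have hR2 : (Real.sqrt N * Real.sqrt q) ^ 2 = (N : ℝ) * q := by
    rw [mul_pow, Real.sq_sqrt hN0.le, Real.sq_sqrt hq0.le]
  have hcore := typeII_block_core hL2 hK0 hN0 hq0 hu0 hKN huK' hlog2K0 hlog2K hlogqN0 hlogqN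
    (by positivity) (by positivity) (by positivity) hP2 hQ2 hR2
  have hD0 : 0 ≤ 64 * Real.log N ^ 3 *
      (N / Real.sqrt q + 2 * (N / Real.sqrt u) + Real.sqrt N * Real.sqrt q) := by positivity
  rw [← Real.sqrt_mul (by positivity), ← Real.sqrt_sq hD0]
  refine Real.sqrt_le_sqrt ?_
  convert hcore using 2

/-- **The Type II bound** (as `Sieve.Vinogradov.norm_S4_le`): for `|α - a/q| ≤ q⁻²`, `(a, q) = 1`,
`1 ≤ q ≤ N`, `N ≥ 3`, `1 ≤ u`,
`‖∑_{n ≤ N} (G_u ⋆ (μ - μ_{≤u}))(n) e(nα)‖ ≤ 256 (log N)⁴ (N/√q + 2N/√u + √N √q)`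
(dyadic blocks `(u2^i, u2^{i+1}]`, each bounded by `typeII_block_le`, empty beyond `N/u`).
[cite: Nathanson1996, §8.5, Lemma 8.8] -/
theorem norm_typeII_le {α : ℝ} {a : ℤ} {q : ℕ} (hq : 1 ≤ q) (hcop : IsCoprime a q)
    (hα : |α - a / q| ≤ 1 / (q : ℝ) ^ 2) {N u : ℕ} (hN : 3 ≤ N) (hqN : q ≤ N) (hu : 1 ≤ u) :
    ‖afExpSum (⇑(gU u * moebiusTail u)) N α‖ ≤
      256 * Real.log N ^ 4 *
        (N / Real.sqrt q + 2 * (N / Real.sqrt u) + Real.sqrt N * Real.sqrt q) := by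
  have hN2 : 2 ≤ N := le_trans (by norm_num) hN
  rw [afExpSum_mul]
  set h := Nat.log 2 N + 1 with hh
  have hN0 : N ≠ 0 := by omega
  have hNh : N ≤ u * 2 ^ h := by
    have h1 : N < 2 ^ h := Nat.lt_pow_succ_log_self (by norm_num) N
    have h2 : 2 ^ h ≤ u * 2 ^ h := Nat.le_mul_of_pos_left _ hu
    omega
  set D : ℝ := 64 * Real.log N ^ 3 *
    (N / Real.sqrt q + 2 * (N / Real.sqrt u) + Real.sqrt N * Real.sqrt q) with hD
  have hlogN : 0 ≤ Real.log N := Real.log_natCast_nonneg N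
  have hD0 : 0 ≤ D := by positivity
  rw [sum_Icc_eq_sum_dyadic hNh _ ?hf0 ?hfN]
  case hf0 =>
    intro k hk
    rw [gU_eq_zero_of_le hk]; simp
  case hfN =>
    intro k hk
    have : N / k = 0 := Nat.div_eq_of_lt hk
    rw [this]; simp
  refine (norm_sum_le _ _).trans ?_
  have hblock : ∀ i ∈ range h,
      ‖∑ k ∈ Ioc (u * 2 ^ i) (u * 2 ^ i + u * 2 ^ i), (gU u k : ℂ) *
          ∑ ℓ ∈ Icc 1 (N / k), (moebiusTail u ℓ : ℂ) * (𝐞 ((ℓ : ℝ) * (α * k)) : ℂ)‖ ≤ D := by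
    intro i _
    set K := u * 2 ^ i with hK
    rw [← two_mul K]
    have huK : u ≤ K := Nat.le_mul_of_pos_right u (Nat.two_pow_pos i)
    by_cases hKu : K * u ≤ N
    · exact typeII_block_le hq hcop hα hN hqN hu huK hKu
    · rw [Finset.sum_eq_zero]
      · simpa using hD0
      intro k hk
      have hKk : K < k := (Finset.mem_Ioc.mp hk).1
      have hk0 : 0 < k := by omega
      have hNk : N / k < u := by
        rw [Nat.div_lt_iff_lt_mul hk0]
        calc N < K * u := not_le.mp hKu
          _ ≤ u * k := by rw [mul_comm]; exact Nat.mul_le_mul_left u hKk.le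
      have hT : ∑ ℓ ∈ Icc 1 (N / k), (moebiusTail u ℓ : ℂ) * (𝐞 ((ℓ : ℝ) * (α * k)) : ℂ) = 0 := by
        refine Finset.sum_eq_zero fun ℓ hℓ => ?_
        have hℓu : ℓ ≤ u := by have := (Finset.mem_Icc.mp hℓ).2; omega
        rw [moebiusTail_apply, if_pos hℓu]; simp
      rw [hT, mul_zero]
  refine (Finset.sum_le_sum hblock).trans ?_
  rw [Finset.sum_const, Finset.card_range, nsmul_eq_mul]
  -- `h ≤ 4 log N`
  have hL2 : 1 / 2 < Real.log N := half_lt_log hN2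
  have hlog2 := Real.log_two_gt_d9
  have hhL : (h : ℝ) ≤ 4 * Real.log N := by
    have h1 : ((Nat.log 2 N : ℕ) : ℝ) * Real.log 2 ≤ Real.log N := by
      rw [← Real.log_pow]
      apply Real.log_le_log (by positivity)
      exact_mod_cast Nat.pow_log_le_self 2 hN0
    have h2 : ((Nat.log 2 N : ℕ) : ℝ) ≤ 2 * Real.log N := by
      by_contra hc
      have hc' := not_le.mp hc
      have : 2 * Real.log N * Real.log 2 < ((Nat.log 2 N : ℕ) : ℝ) * Real.log 2 :=
        mul_lt_mul_of_pos_right hc' (by linarith)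
      nlinarith
    rw [hh]; push_cast; linarith
  calc (h : ℝ) * D ≤ 4 * Real.log N * D := mul_le_mul_of_nonneg_right hhL hD0
    _ = _ := by rw [hD]; ring

/-! ### Assembly: the Vinogradov-type bound for `∑ μ(n) e(nα)` -/

/-- **Exponential sums over the Möbius function** (Davenport; Iwaniec–Kowalski Theorem 13.9 in
a weaker but explicit form): for `N ≥ 3`, `1 ≤ q ≤ N`, `(a, q) = 1`, `|α - a/q| ≤ q⁻²`,
`‖∑_{n ≤ N} μ(n) e(nα)‖ ≤ 1100 (N/√q + N^{9/10} + √N √q) (log N)⁴`.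
(Vaughan's identity `moebius_eq_three_terms` with `U = ⌊N^{2/5}⌋`, `norm_typeI_le`,
`norm_typeII_le`.) [cite: Green2012, §4 (Proposition 4, "may be established using the method of
Type I/II sums or bilinear forms, perhaps most easily by utilising Vaughan's identity")] -/
theorem norm_afExpSum_moebius_le {α : ℝ} {a : ℤ} {q : ℕ} (hq : 1 ≤ q) (hcop : IsCoprime a q)
    (hα : |α - a / q| ≤ 1 / (q : ℝ) ^ 2) {N : ℕ} (hN : 3 ≤ N) (hqN : q ≤ N) :
    ‖afExpSum (⇑(μ : ArithmeticFunction ℝ)) N α‖ ≤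
      1100 * ((N : ℝ) / Real.sqrt q + (N : ℝ) ^ (9 / 10 : ℝ) + Real.sqrt N * Real.sqrt q) *
        Real.log N ^ 4 := by
  have hN1 : 1 ≤ N := le_trans (by norm_num) hN
  obtain ⟨hu1, huN, hu2, hu3⟩ := floor_rpow_two_fifths_bounds hN1
  set u : ℕ := ⌊(N : ℝ) ^ (2 / 5 : ℝ)⌋₊ with hu
  have hN0 : (0 : ℝ) < N := by exact_mod_cast (by omega : 0 < N)
  have hN1' : (1 : ℝ) ≤ N := by exact_mod_cast hN1
  have hq0 : (0 : ℝ) < q := by exact_mod_cast hq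
  have hL1 : 1 ≤ Real.log N := one_le_log_of_three_le hN
  set L := Real.log N with hL
  -- `u² ≤ N`
  have h45 : (N : ℝ) ^ (4 / 5 : ℝ) ≤ (N : ℝ) ^ (9 / 10 : ℝ) :=
    Real.rpow_le_rpow_of_exponent_le hN1' (by norm_num)
  have h910 : (N : ℝ) ^ (9 / 10 : ℝ) ≤ N := by
    calc (N : ℝ) ^ (9 / 10 : ℝ) ≤ (N : ℝ) ^ (1 : ℝ) := Real.rpow_le_rpow_of_exponent_le hN1' (by norm_num)
      _ = N := Real.rpow_one _
  have huuN : u * u ≤ N := by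
    have : ((u * u : ℕ) : ℝ) ≤ N := by
      push_cast
      rw [← sq]
      exact hu2.trans (h45.trans h910)
    exact_mod_cast this
  have hu0 : (0 : ℝ) < u := by exact_mod_cast hu1
  have hule : (u : ℝ) ≤ (N : ℝ) ^ (2 / 5 : ℝ) := Nat.floor_le (by positivity)
  -- the three pieces
  rw [afExpSum_moebius_eq u N α]
  have hA := norm_afExpSum_moebiusTrunc_le u N α
  have hB := norm_typeI_le hq hcop hα hN hqN hu1 huuN
  have hC := norm_typeII_le hq hcop hα hN hqN hu1
  -- elementary comparisons
  have hsqrtN : Real.sqrt N * u ≤ (N : ℝ) ^ (9 / 10 : ℝ) := by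
    rw [Real.sqrt_eq_rpow, show (9 / 10 : ℝ) = 1 / 2 + 2 / 5 by norm_num, Real.rpow_add hN0]
    exact mul_le_mul_of_nonneg_left hule (by positivity)
  have hu_le : (u : ℝ) ≤ (N : ℝ) ^ (9 / 10 : ℝ) := by
    have : (u : ℝ) ≤ (u : ℝ) ^ 2 := by
      have hu1' : (1 : ℝ) ≤ u := by exact_mod_cast hu1
      nlinarith
    exact this.trans (hu2.trans h45)
  have hNu : (N : ℝ) / Real.sqrt u ≤ 2 * (N : ℝ) ^ (9 / 10 : ℝ) := hu3.trans (by linarith)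
  have hP0 : 0 ≤ (N : ℝ) / Real.sqrt q := by positivity
  have hR0 : 0 ≤ Real.sqrt N * Real.sqrt q := by positivity
  have h9 : 0 ≤ (N : ℝ) ^ (9 / 10 : ℝ) := by positivity
  have hL3 : L ^ 3 ≤ L ^ 4 := by
    calc L ^ 3 = L ^ 3 * 1 := (mul_one _).symm
      _ ≤ L ^ 3 * L := mul_le_mul_of_nonneg_left hL1 (by positivity)
      _ = L ^ 4 := by ring
  have hL4 : 1 ≤ L ^ 4 := one_le_pow₀ hL1
  calc ‖2 * afExpSum (⇑(moebiusTrunc u : ArithmeticFunction ℝ)) N α -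
        afExpSum (⇑((moebiusTrunc u : ArithmeticFunction ℝ) * (moebiusTrunc u : ArithmeticFunction ℝ) *
          (ζ : ArithmeticFunction ℝ))) N α + afExpSum (⇑(gU u * moebiusTail u)) N α‖
      ≤ ‖2 * afExpSum (⇑(moebiusTrunc u : ArithmeticFunction ℝ)) N α‖ +
        ‖afExpSum (⇑((moebiusTrunc u : ArithmeticFunction ℝ) * (moebiusTrunc u : ArithmeticFunction ℝ) *
          (ζ : ArithmeticFunction ℝ))) N α‖ + ‖afExpSum (⇑(gU u * moebiusTail u)) N α‖ := by
        refine (norm_add_le _ _).trans (add_le_add ((norm_sub_le _ _).trans le_rfl) le_rfl)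
    _ ≤ 2 * u + 20 * L ^ 3 * (N / Real.sqrt q + Real.sqrt N * u + Real.sqrt N * Real.sqrt q) +
        256 * L ^ 4 * (N / Real.sqrt q + 2 * (N / Real.sqrt u) + Real.sqrt N * Real.sqrt q) := by
        refine add_le_add (add_le_add ?_ hB) hC
        rw [norm_mul, Complex.norm_ofNat]
        linarith
    _ ≤ 2 * (N : ℝ) ^ (9 / 10 : ℝ) +
        20 * L ^ 4 * (N / Real.sqrt q + (N : ℝ) ^ (9 / 10 : ℝ) + Real.sqrt N * Real.sqrt q) +
        256 * L ^ 4 * (N / Real.sqrt q + 4 * (N : ℝ) ^ (9 / 10 : ℝ) + Real.sqrt N * Real.sqrt q) := by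
        have h1 : 2 * (u : ℝ) ≤ 2 * (N : ℝ) ^ (9 / 10 : ℝ) := by linarith
        have h2 : 20 * L ^ 3 * (N / Real.sqrt q + Real.sqrt N * u + Real.sqrt N * Real.sqrt q) ≤
            20 * L ^ 4 * (N / Real.sqrt q + (N : ℝ) ^ (9 / 10 : ℝ) + Real.sqrt N * Real.sqrt q) := by
          have hX : (N : ℝ) / Real.sqrt q + Real.sqrt N * u + Real.sqrt N * Real.sqrt q ≤
              N / Real.sqrt q + (N : ℝ) ^ (9 / 10 : ℝ) + Real.sqrt N * Real.sqrt q := by linarith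
          have hX0 : 0 ≤ (N : ℝ) / Real.sqrt q + Real.sqrt N * u + Real.sqrt N * Real.sqrt q := by
            positivity
          calc 20 * L ^ 3 * (N / Real.sqrt q + Real.sqrt N * u + Real.sqrt N * Real.sqrt q)
              ≤ 20 * L ^ 4 * (N / Real.sqrt q + Real.sqrt N * u + Real.sqrt N * Real.sqrt q) := by
                gcongr
            _ ≤ _ := by gcongr
        have h3 : 256 * L ^ 4 * (N / Real.sqrt q + 2 * (N / Real.sqrt u) + Real.sqrt N * Real.sqrt q) ≤
            256 * L ^ 4 * (N / Real.sqrt q + 4 * (N : ℝ) ^ (9 / 10 : ℝ) + Real.sqrt N * Real.sqrt q) := by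
          refine mul_le_mul_of_nonneg_left ?_ (by positivity)
          linarith
        linarith
    _ ≤ 1100 * ((N : ℝ) / Real.sqrt q + (N : ℝ) ^ (9 / 10 : ℝ) + Real.sqrt N * Real.sqrt q) * L ^ 4 := by
        have hL40 : 0 ≤ L ^ 4 := by positivity
        have key : 1100 * ((N : ℝ) / Real.sqrt q + (N : ℝ) ^ (9 / 10 : ℝ) + Real.sqrt N * Real.sqrt q) * L ^ 4 -
            (2 * (N : ℝ) ^ (9 / 10 : ℝ) +
              20 * L ^ 4 * (N / Real.sqrt q + (N : ℝ) ^ (9 / 10 : ℝ) + Real.sqrt N * Real.sqrt q) +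
              256 * L ^ 4 * (N / Real.sqrt q + 4 * (N : ℝ) ^ (9 / 10 : ℝ) + Real.sqrt N * Real.sqrt q)) =
            824 * (L ^ 4 * (N / Real.sqrt q)) + 54 * (L ^ 4 * (N : ℝ) ^ (9 / 10 : ℝ)) +
              824 * (L ^ 4 * (Real.sqrt N * Real.sqrt q)) + 2 * ((N : ℝ) ^ (9 / 10 : ℝ) * (L ^ 4 - 1)) := by
          ring
        have t4 : 0 ≤ (N : ℝ) ^ (9 / 10 : ℝ) * (L ^ 4 - 1) := mul_nonneg h9 (by linarith only [hL4])
        rw [← sub_nonneg, key]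
        exact add_nonneg (add_nonneg (add_nonneg (mul_nonneg (by norm_num) (mul_nonneg hL40 hP0))
          (mul_nonneg (by norm_num) (mul_nonneg hL40 h9))) (mul_nonneg (by norm_num) (mul_nonneg hL40 hR0)))
          (mul_nonneg zero_le_two t4)

/-! ### Green 2012, Proposition 4 (the minor arcs) for `μ` -/

/-- The trivial bound `‖∑_{n ≤ N} μ(n) e(nθ)‖ ≤ N`. [folklore] -/
theorem norm_afExpSum_moebius_le_self (N : ℕ) (θ : ℝ) :
    ‖afExpSum (⇑(μ : ArithmeticFunction ℝ)) N θ‖ ≤ N := by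
  refine (norm_afExpSum_le _ N θ).trans ?_
  calc ∑ n ∈ Icc 1 N, |(μ : ArithmeticFunction ℝ) n| ≤ ∑ _n ∈ Icc 1 N, (1 : ℝ) :=
        Finset.sum_le_sum fun n _ => by rw [intCoe_apply]; exact_mod_cast abs_moebius_le_one
    _ = N := by simp

/-- **Green 2012, Proposition 4 (Möbius, minor arcs)**: there is an absolute `C ≥ 1` such that
for `N ≥ 3`, `0 < δ ≤ 1` and any real `θ` with `‖∑_{n ≤ N} μ(n) e(nθ)‖ ≥ δN`, there are
`1 ≤ q ≤ (C (log N)⁴/δ)^{20}` and `a` coprime to `q` with `|θ - a/q| ≤ (C (log N)⁴/δ)^{20}/N`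
(printed: "some `q ≪ (log N/δ)^{16}` such that `|θ - a/q| ≪ (log N/δ)^{16} N^{-1}`"; the
exponent is immaterial). Proof as printed: Dirichlet's theorem with
`Q = δ²N/(9B²)`, `B = 1100 (log N)⁴`, and `norm_afExpSum_moebius_le`. [cite: Green2012, Proposition 4] -/
theorem moebius_minorArc :
    ∃ C : ℝ, 1 ≤ C ∧ ∀ N : ℕ, 3 ≤ N → ∀ (θ δ : ℝ), 0 < δ → δ ≤ 1 →
      δ * N ≤ ‖afExpSum (⇑(μ : ArithmeticFunction ℝ)) N θ‖ →
      ∃ q : ℕ, 1 ≤ q ∧ (q : ℝ) ≤ (C * Real.log N ^ 4 / δ) ^ 20 ∧ ∃ a : ℤ, IsCoprime a q ∧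
        |θ - a / q| ≤ (C * Real.log N ^ 4 / δ) ^ 20 / N := by
  refine ⟨3300, by norm_num, fun N hN θ δ hδ hδ1 hbig => ?_⟩
  have hN0 : (0 : ℝ) < N := by exact_mod_cast (by omega : 0 < N)
  have hN1 : (1 : ℝ) ≤ N := by exact_mod_cast (by omega : 1 ≤ N)
  have hL1 : 1 ≤ Real.log N := one_le_log_of_three_le hN
  set L := Real.log N with hL
  have hL4 : 1 ≤ L ^ 4 := one_le_pow₀ hL1
  set B : ℝ := 1100 * L ^ 4 with hB
  have hB1 : 1 ≤ B := by rw [hB]; nlinarith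
  set P : ℝ := 3300 * L ^ 4 / δ with hP
  have hP3B : P = 3 * B / δ := by rw [hP, hB]; ring
  have hP1 : 1 ≤ P := by
    rw [hP3B, le_div_iff₀ hδ]; nlinarith
  have hP0 : 0 < P := by linarith
  -- the trivial case
  by_cases htriv : (N : ℝ) ≤ P ^ 20
  · refine ⟨1, le_rfl, by simpa using one_le_pow₀ (n := 20) hP1, round θ, isCoprime_one_right, ?_⟩
    rw [Nat.cast_one, div_one]
    calc |θ - round θ| ≤ 1 / 2 := abs_sub_round θ
      _ ≤ 1 := by norm_num
      _ ≤ P ^ 20 / N := by rw [le_div_iff₀ hN0, one_mul]; exact htriv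
  push Not at htriv
  -- the main case: `N > P^20`, so `δ > 3B N^{-1/20}`
  have hQdef : 0 < δ ^ 2 * N / (9 * B ^ 2) := by positivity
  set Q : ℝ := δ ^ 2 * N / (9 * B ^ 2) with hQ
  have hPN : P < (N : ℝ) ^ ((20 : ℕ) : ℝ)⁻¹ := by
    have h := Real.rpow_lt_rpow (by positivity) htriv (by norm_num : (0 : ℝ) < ((20 : ℕ) : ℝ)⁻¹)
    rwa [Real.pow_rpow_inv_natCast hP0.le (by norm_num)] at h
  have hQ1 : 1 ≤ Q := by
    -- `δ² N ≥ δ^20 N > (3B)^20 ≥ (3B)²`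
    rw [hQ, le_div_iff₀ (by positivity), one_mul]
    have h1 : P ^ 20 < N := htriv
    have h2 : P ^ 20 = (3 * B) ^ 20 / δ ^ 20 := by rw [hP3B, div_pow]
    rw [h2, div_lt_iff₀ (by positivity)] at h1
    have h3B : 1 ≤ 3 * B := by linarith
    have h3 : (3 * B) ^ 2 ≤ (3 * B) ^ 20 := pow_le_pow_right₀ h3B (by norm_num)
    have h4 : δ ^ 20 ≤ δ ^ 2 := pow_le_pow_of_le_one hδ.le hδ1 (by norm_num)
    have h5 : (N : ℝ) * δ ^ 20 ≤ N * δ ^ 2 := mul_le_mul_of_nonneg_left h4 hN0.le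
    have h6 : (3 * B) ^ 2 = 9 * B ^ 2 := by ring
    linarith
  have hQN : Q ≤ N := by
    rw [hQ, div_le_iff₀ (by positivity)]
    have : δ ^ 2 ≤ 1 := pow_le_one₀ hδ.le hδ1
    nlinarith [one_le_pow₀ (n := 2) hB1]
  -- Dirichlet
  set n : ℕ := ⌊Q⌋₊ with hn
  have hn1 : 0 < n := Nat.floor_pos.mpr hQ1
  obtain ⟨r, hr, hrn⟩ := Real.exists_rat_abs_sub_le_and_den_le θ hn1
  have hqpos : 0 < r.den := r.den_pos
  have hq1 : 1 ≤ r.den := hqpos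
  have hq0 : (0 : ℝ) < r.den := by exact_mod_cast hqpos
  have hnQ : (n : ℝ) ≤ Q := Nat.floor_le hQdef.le
  have hQn : Q < (n : ℝ) + 1 := Nat.lt_floor_add_one Q
  have hqQ : (r.den : ℝ) ≤ Q := le_trans (by exact_mod_cast hrn) hnQ
  have hqN : r.den ≤ N := by
    have : (r.den : ℝ) ≤ N := hqQ.trans hQN
    exact_mod_cast this
  have hcop : IsCoprime r.num (r.den : ℤ) := Int.isCoprime_iff_gcd_eq_one.mpr r.reduced
  have hθr : (r : ℝ) = (r.num : ℝ) / (r.den : ℝ) := by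
    rw [Rat.cast_def]
  have hα : |θ - r.num / r.den| ≤ 1 / (r.den : ℝ) ^ 2 := by
    rw [← hθr]
    refine hr.trans ?_
    rw [div_le_div_iff₀ (by positivity) (by positivity), one_mul, one_mul, sq]
    have : (r.den : ℝ) ≤ n := by exact_mod_cast hrn
    nlinarith
  have hα' : |θ - r.num / r.den| ≤ 1 / Q := by
    rw [← hθr]
    refine hr.trans ?_
    rw [div_le_div_iff₀ (by positivity) (by positivity), one_mul, one_mul]
    have h1 : (1 : ℝ) ≤ r.den := by exact_mod_cast hq1
    nlinarith
  -- apply the bound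
  have hbound := norm_afExpSum_moebius_le hq1 hcop hα hN hqN
  have hmain : δ * N ≤ B * (N / Real.sqrt r.den + (N : ℝ) ^ (9 / 10 : ℝ) + Real.sqrt N * Real.sqrt r.den) := by
    refine hbig.trans (hbound.trans (le_of_eq ?_)); rw [hB]; ring
  -- `B √N √q ≤ δN/3`
  have h1 : B * (Real.sqrt N * Real.sqrt r.den) ≤ δ * N / 3 := by
    have hsq : Real.sqrt N * Real.sqrt r.den ≤ δ * N / (3 * B) := by
      rw [← Real.sqrt_mul hN0.le, Real.sqrt_le_left (by positivity)]
      calc (N : ℝ) * r.den ≤ N * Q := mul_le_mul_of_nonneg_left hqQ hN0.le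
        _ = (δ * N / (3 * B)) ^ 2 := by rw [hQ]; field_simp; ring
    calc B * (Real.sqrt N * Real.sqrt r.den) ≤ B * (δ * N / (3 * B)) :=
          mul_le_mul_of_nonneg_left hsq (by positivity)
      _ = δ * N / 3 := by field_simp
  -- `B N^{9/10} ≤ δN/3`
  have h2 : B * (N : ℝ) ^ (9 / 10 : ℝ) ≤ δ * N / 3 := by
    -- `3B/δ = P < N^{1/20} ≤ N^{1/10}`, and `N = N^{9/10} N^{1/10}`
    have h20 : (N : ℝ) ^ ((20 : ℕ) : ℝ)⁻¹ ≤ (N : ℝ) ^ (1 / 10 : ℝ) :=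
      Real.rpow_le_rpow_of_exponent_le hN1 (by norm_num)
    have hP' : 3 * B / δ ≤ (N : ℝ) ^ (1 / 10 : ℝ) := by rw [← hP3B]; exact (hPN.le.trans h20)
    have hsplit : (N : ℝ) = (N : ℝ) ^ (9 / 10 : ℝ) * (N : ℝ) ^ (1 / 10 : ℝ) := by
      rw [← Real.rpow_add hN0]; norm_num
    rw [div_le_iff₀ hδ] at hP'
    have h9 : 0 ≤ (N : ℝ) ^ (9 / 10 : ℝ) := by positivity
    calc B * (N : ℝ) ^ (9 / 10 : ℝ) = (3 * B) * (N : ℝ) ^ (9 / 10 : ℝ) / 3 := by ring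
      _ ≤ ((N : ℝ) ^ (1 / 10 : ℝ) * δ) * (N : ℝ) ^ (9 / 10 : ℝ) / 3 := by gcongr
      _ = δ * N / 3 := by
          conv_rhs => rw [hsplit]
          ring
  -- hence `δN/3 ≤ B N/√q`, i.e. `q ≤ (3B/δ)² = P²`
  have h3 : δ * N / 3 ≤ B * (N / Real.sqrt r.den) := by
    have e : B * (N / Real.sqrt r.den + (N : ℝ) ^ (9 / 10 : ℝ) + Real.sqrt N * Real.sqrt r.den) =
        B * (N / Real.sqrt r.den) + B * (N : ℝ) ^ (9 / 10 : ℝ) + B * (Real.sqrt N * Real.sqrt r.den) := by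
      ring
    linarith
  have hqP : (r.den : ℝ) ≤ P ^ 2 := by
    have hs0 : 0 < Real.sqrt r.den := Real.sqrt_pos.mpr hq0
    have h4 : Real.sqrt r.den ≤ 3 * B / δ := by
      rw [le_div_iff₀ hδ]
      have h3' := h3
      rw [mul_div_assoc', le_div_iff₀ hs0] at h3'
      have e : (N : ℝ) * (Real.sqrt r.den * δ) = 3 * (δ * N / 3 * Real.sqrt r.den) := by ring
      have h5 : (N : ℝ) * (Real.sqrt r.den * δ) ≤ N * (3 * B) := by linarith
      exact le_of_mul_le_mul_left h5 hN0
    calc (r.den : ℝ) = Real.sqrt r.den ^ 2 := (Real.sq_sqrt hq0.le).symm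
      _ ≤ (3 * B / δ) ^ 2 := pow_le_pow_left₀ hs0.le h4 2
      _ = P ^ 2 := by rw [hP3B]
  have hP2 : P ^ 2 ≤ P ^ 20 := pow_le_pow_right₀ hP1 (by norm_num)
  -- `1/Q = 9B²/(δ²N) = P²/N ≤ P^20/N`
  have hQinv : 1 / Q = P ^ 2 / N := by
    rw [hQ, hP3B]
    field_simp
    ring
  have hfinal : |θ - r.num / r.den| ≤ P ^ 20 / N :=
    hα'.trans (by rw [hQinv]; exact div_le_div_of_nonneg_right hP2 hN0.le)
  exact ⟨r.den, hq1, hqP.trans hP2, r.num, hcop, hfinal⟩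

/-! ### The Liouville function: `λ = 𝟙_□ ⋆ μ` and Proposition 4 for `λ` -/

/-- **`∑_{n ≤ N} λ(n) e(nθ) = ∑_{d ≤ N, d = □} ∑_{m ≤ N/d} μ(m) e(m dθ)`** (from `λ = 𝟙_□ ⋆ μ`,
the tree's `LiouvilleSum.coe_liouville_eq_zeta_mul_liouville_mul_moebius`, and
`Sieve.Vinogradov.afExpSum_mul`). [folklore] -/
theorem afExpSum_liouville_eq (N : ℕ) (θ : ℝ) :
    afExpSum (⇑(liouville : ArithmeticFunction ℝ)) N θ =
      ∑ d ∈ Icc 1 N, (if IsSquare d then (1 : ℂ) else 0) *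
        afExpSum (⇑(μ : ArithmeticFunction ℝ)) (N / d) (θ * d) := by
  conv_lhs => rw [LiouvilleSum.coe_liouville_eq_zeta_mul_liouville_mul_moebius]
  rw [afExpSum_mul]
  refine Finset.sum_congr rfl fun d hd => ?_
  have hd0 : d ≠ 0 := by have := (Finset.mem_Icc.mp hd).1; omega
  rw [LiouvilleSum.zeta_mul_liouville_apply hd0]
  congr 1
  · split_ifs <;> simp

/-- The trivial bound `‖∑_{n ≤ N} λ(n) e(nθ)‖ ≤ N`. [folklore] -/
theorem norm_afExpSum_liouville_le_self (N : ℕ) (θ : ℝ) :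
    ‖afExpSum (⇑(liouville : ArithmeticFunction ℝ)) N θ‖ ≤ N := by
  refine (norm_afExpSum_le _ N θ).trans ?_
  calc ∑ n ∈ Icc 1 N, |(liouville : ArithmeticFunction ℝ) n| ≤ ∑ _n ∈ Icc 1 N, (1 : ℝ) :=
        Finset.sum_le_sum fun n _ => by rw [intCoe_apply]; exact LiouvilleSum.abs_liouville_le_one n
    _ = N := by simp

/-- **Squares up to `N` are the `a²`, `a ≤ √N`**: reindexing a sum over the squares in `[1, N]`.
[folklore] -/
theorem sum_filter_isSquare_eq {M : Type*} [AddCommMonoid M] (f : ℕ → M) (N : ℕ) :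
    ∑ d ∈ (Icc 1 N).filter IsSquare, f d = ∑ a ∈ Icc 1 (Nat.sqrt N), f (a * a) := by
  refine Finset.sum_nbij' (fun d => Nat.sqrt d) (fun a => a * a) ?_ ?_ ?_ ?_ ?_
  · intro d hd
    rw [Finset.mem_filter, Finset.mem_Icc] at hd
    obtain ⟨⟨hd1, hdN⟩, r, hr⟩ := hd
    rw [Finset.mem_Icc, hr, Nat.sqrt_eq]
    constructor
    · rcases Nat.eq_zero_or_pos r with rfl | hr0
      · omega
      · exact hr0
    · rw [← Nat.sqrt_eq r]; exact Nat.sqrt_le_sqrt (hr ▸ hdN)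
  · intro a ha
    rw [Finset.mem_Icc] at ha
    rw [Finset.mem_filter, Finset.mem_Icc]
    refine ⟨⟨Nat.mul_pos ha.1 ha.1, Nat.le_sqrt.mp ha.2⟩, a, rfl⟩
  · intro d hd
    rw [Finset.mem_filter] at hd
    obtain ⟨-, r, hr⟩ := hd
    simp only [hr, Nat.sqrt_eq]
  · intro a _
    simp only [Nat.sqrt_eq]
  · intro d hd
    rw [Finset.mem_filter] at hd
    obtain ⟨-, r, hr⟩ := hd
    simp only [hr, Nat.sqrt_eq]

/-- `∑_{n ≤ N} λ(n) e(nθ)` as a sum over `a ≤ √N` of Möbius sums of length `N/a²` at `a²θ`.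
[folklore] -/
theorem afExpSum_liouville_eq_sum_sqrt (N : ℕ) (θ : ℝ) :
    afExpSum (⇑(liouville : ArithmeticFunction ℝ)) N θ =
      ∑ a ∈ Icc 1 (Nat.sqrt N), afExpSum (⇑(μ : ArithmeticFunction ℝ)) (N / (a * a)) (θ * (a * a : ℕ)) := by
  rw [afExpSum_liouville_eq, ← sum_filter_isSquare_eq (fun d =>
    afExpSum (⇑(μ : ArithmeticFunction ℝ)) (N / d) (θ * (d : ℕ))) N, Finset.sum_filter]
  refine Finset.sum_congr rfl fun d _ => ?_
  split_ifs <;> simp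

/-- **Pigeonholing the squares**: if `‖∑_{n ≤ N} λ(n)e(nθ)‖ ≥ δN` (`N ≥ 3`), some `a ≤ √N` has
`‖∑_{m ≤ N/a²} μ(m) e(m a²θ)‖ ≥ (δ/(4 log N)) N/a` (since `∑_{a ≤ √N} 1/a ≤ 2 log N`). [folklore] -/
theorem exists_sqrt_moebius_large {N : ℕ} (hN : 3 ≤ N) {θ δ : ℝ} (hδ : 0 < δ)
    (hbig : δ * N ≤ ‖afExpSum (⇑(liouville : ArithmeticFunction ℝ)) N θ‖) :
    ∃ a ∈ Icc 1 (Nat.sqrt N), δ / (4 * Real.log N) * N / a ≤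
      ‖afExpSum (⇑(μ : ArithmeticFunction ℝ)) (N / (a * a)) (θ * (a * a : ℕ))‖ := by
  have hN0 : (0 : ℝ) < N := by exact_mod_cast (by omega : 0 < N)
  have hL1 : 1 ≤ Real.log N := one_le_log_of_three_le hN
  by_contra hcon
  push Not at hcon
  have hH : ∑ a ∈ Icc 1 (Nat.sqrt N), (1 : ℝ) / a ≤ 2 * Real.log N := by
    have h1 := Literature.NumberTheory.Sieve.Vaughan.sum_Ioc_inv_le (Nat.sqrt N)
    rw [Literature.NumberTheory.Sieve.Vaughan.Ioc_zero_eq_Icc_one] at h1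
    have h2 : Real.log (Nat.sqrt N) ≤ Real.log N := by
      rcases Nat.eq_zero_or_pos (Nat.sqrt N) with h0 | hpos
      · rw [h0, Nat.cast_zero, Real.log_zero]; linarith
      · exact Real.log_le_log (by exact_mod_cast hpos) (by exact_mod_cast Nat.sqrt_le_self N)
    calc ∑ a ∈ Icc 1 (Nat.sqrt N), (1 : ℝ) / a = ∑ a ∈ Icc 1 (Nat.sqrt N), (a : ℝ)⁻¹ :=
          Finset.sum_congr rfl fun a _ => one_div _
      _ ≤ 1 + Real.log (Nat.sqrt N) := h1
      _ ≤ 2 * Real.log N := by linarith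
  have hsum : ‖afExpSum (⇑(liouville : ArithmeticFunction ℝ)) N θ‖ ≤ δ / 2 * N := by
    rw [afExpSum_liouville_eq_sum_sqrt]
    refine (norm_sum_le _ _).trans ?_
    calc ∑ a ∈ Icc 1 (Nat.sqrt N), ‖afExpSum (⇑(μ : ArithmeticFunction ℝ)) (N / (a * a)) (θ * (a * a : ℕ))‖
        ≤ ∑ a ∈ Icc 1 (Nat.sqrt N), δ / (4 * Real.log N) * N * (1 / a) :=
          Finset.sum_le_sum fun a ha => by
            have := (hcon a ha).le
            calc _ ≤ δ / (4 * Real.log N) * N / a := this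
              _ = δ / (4 * Real.log N) * N * (1 / a) := by ring
      _ = δ / (4 * Real.log N) * N * ∑ a ∈ Icc 1 (Nat.sqrt N), (1 : ℝ) / a := by rw [Finset.mul_sum]
      _ ≤ δ / (4 * Real.log N) * N * (2 * Real.log N) := mul_le_mul_of_nonneg_left hH (by positivity)
      _ = δ / 2 * N := by field_simp; ring
  have : δ * N ≤ δ / 2 * N := hbig.trans hsum
  nlinarith [mul_pos hδ hN0]

/-- **From an approximation of `dθ` to one of `θ`**: if `|dθ - b/q'| ≤ E` with `d, q' ≥ 1`, then
the reduced fraction `a/q` of `b/(q'd)` has `1 ≤ q ≤ q'd`, `(a, q) = 1` and `|θ - a/q| ≤ E/d`.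
[folklore] -/
theorem exists_reduced_approx {θ E : ℝ} {d q' : ℕ} (hd : 1 ≤ d) (hq' : 1 ≤ q') {b : ℤ}
    (h : |θ * d - b / q'| ≤ E) :
    ∃ q : ℕ, 1 ≤ q ∧ q ≤ q' * d ∧ ∃ a : ℤ, IsCoprime a q ∧ |θ - a / q| ≤ E / d := by
  set ρ : ℚ := Rat.divInt b ((q' * d : ℕ) : ℤ) with hρ
  have hqd0 : 0 < q' * d := Nat.mul_pos hq' hd
  have hd0 : (0 : ℝ) < d := by exact_mod_cast hd
  have hq'0 : (0 : ℝ) < q' := by exact_mod_cast hq'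
  have hρden : ρ.den ≤ q' * d := by
    have h1 : (ρ.den : ℤ) ∣ ((q' * d : ℕ) : ℤ) := Rat.den_dvd b ((q' * d : ℕ) : ℤ)
    have := Int.le_of_dvd (by exact_mod_cast hqd0) h1
    exact_mod_cast this
  have hρval : (ρ : ℝ) = (b : ℝ) / ((q' : ℝ) * d) := by
    rw [hρ, Rat.divInt_eq_div]; push_cast; ring
  have hρval' : (ρ : ℝ) = (ρ.num : ℝ) / (ρ.den : ℝ) := Rat.cast_def ρ
  have hcop : IsCoprime ρ.num (ρ.den : ℤ) := Int.isCoprime_iff_gcd_eq_one.mpr ρ.reduced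
  refine ⟨ρ.den, ρ.den_pos, hρden, ρ.num, hcop, ?_⟩
  rw [← hρval', hρval]
  have e : θ - (b : ℝ) / ((q' : ℝ) * d) = (θ * d - b / q') / d := by field_simp
  rw [e, abs_div, abs_of_pos hd0]
  exact div_le_div_of_nonneg_right h hd0.le

/-- **Green 2012, Proposition 4 for the Liouville function** (minor arcs): there is an absolute
`C ≥ 1` such that for `N ≥ 3`, `0 < δ ≤ 1` and any real `θ` with `‖∑_{n ≤ N} λ(n) e(nθ)‖ ≥ δN`,
there are `1 ≤ q ≤ (C (log N)⁴/δ)^{50}` and `a` coprime to `q` with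
`|θ - a/q| ≤ (C (log N)⁴/δ)^{50}/N`. Deduced from `moebius_minorArc` through
`λ = 𝟙_□ ⋆ μ` (`afExpSum_liouville_eq_sum_sqrt`): some `a ≤ 4 log N/δ` has
`‖∑_{m ≤ N/a²} μ(m) e(m a²θ)‖ ≥ (δ/(4 log N))(N/a²)` (`exists_sqrt_moebius_large`), and a rational
approximation `b/q'` of `a²θ` gives the approximation `b/(q'a²)` of `θ` (`exists_reduced_approx`).
(Green, §1: "All of the results in this paper hold equally well for the Liouville function, with
very similar proofs.") [cite: Green2012, Proposition 4 and §1] -/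
theorem liouville_minorArc :
    ∃ C : ℝ, 1 ≤ C ∧ ∀ N : ℕ, 3 ≤ N → ∀ (θ δ : ℝ), 0 < δ → δ ≤ 1 →
      δ * N ≤ ‖afExpSum (⇑(liouville : ArithmeticFunction ℝ)) N θ‖ →
      ∃ q : ℕ, 1 ≤ q ∧ (q : ℝ) ≤ (C * Real.log N ^ 4 / δ) ^ 50 ∧ ∃ a : ℤ, IsCoprime a q ∧
        |θ - a / q| ≤ (C * Real.log N ^ 4 / δ) ^ 50 / N := by
  obtain ⟨Cμ, hCμ1, hμ⟩ := moebius_minorArc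
  refine ⟨16 * Cμ, by linarith, fun N hN θ δ hδ hδ1 hbig => ?_⟩
  have hN0 : (0 : ℝ) < N := by exact_mod_cast (by omega : 0 < N)
  have hL1 : 1 ≤ Real.log N := one_le_log_of_three_le hN
  have hL0 : 0 < Real.log N := by linarith
  -- the parameter `P = 16 Cμ (log N)⁴/δ ≥ 16 (log N)/δ ≥ 16`
  have hP16 : 16 * Real.log N / δ ≤ 16 * Cμ * Real.log N ^ 4 / δ := by
    rw [div_le_div_iff_of_pos_right hδ]
    have h1 : Real.log N ≤ Real.log N ^ 4 := le_self_pow₀ hL1 (by norm_num)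
    have h4 : 0 ≤ Real.log N ^ 4 := by positivity
    nlinarith only [h1, hCμ1, h4]
  have h16 : (16 : ℝ) ≤ 16 * Real.log N / δ := by
    rw [le_div_iff₀ hδ]; linarith only [hδ1, hL1]
  generalize hP : 16 * Cμ * Real.log N ^ 4 / δ = P at hP16 ⊢
  have hP1 : 1 ≤ P := by linarith only [h16, hP16]
  have hP0 : 0 < P := by linarith only [hP1]
  -- trivial conclusion available when `N ≤ P^50`
  have htriv : (N : ℝ) ≤ P ^ 50 → ∃ q : ℕ, 1 ≤ q ∧ (q : ℝ) ≤ P ^ 50 ∧ ∃ a : ℤ, IsCoprime a q ∧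
      |θ - a / q| ≤ P ^ 50 / N := by
    intro hNP
    refine ⟨1, le_rfl, by simpa using one_le_pow₀ (n := 50) hP1, round θ, isCoprime_one_right, ?_⟩
    rw [Nat.cast_one, div_one]
    calc |θ - round θ| ≤ 1 / 2 := abs_sub_round θ
      _ ≤ 1 := by norm_num
      _ ≤ P ^ 50 / N := by rw [le_div_iff₀ hN0, one_mul]; exact hNP
  by_cases hNP : (N : ℝ) ≤ P ^ 50
  · exact htriv hNP
  push Not at hNP
  -- Step 1: some `a ≤ √N` carries a large Möbius sum
  obtain ⟨a, ha, habig⟩ := exists_sqrt_moebius_large hN hδ hbig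
  have ha1 : 1 ≤ a := (Finset.mem_Icc.mp ha).1
  have ha0 : (0 : ℝ) < a := by exact_mod_cast ha1
  have ha1' : (1 : ℝ) ≤ a := by exact_mod_cast ha1
  have hd1 : 1 ≤ a * a := Nat.mul_pos ha1 ha1
  have hd0 : (0 : ℝ) < (a * a : ℕ) := by exact_mod_cast hd1
  have hdaa : ((a * a : ℕ) : ℝ) = (a : ℝ) * a := by push_cast; ring
  have hN'le : ((N / (a * a) : ℕ) : ℝ) ≤ N / (a * a : ℕ) := Nat.cast_div_le
  have hdN' : (N : ℝ) < ((N / (a * a) : ℕ) : ℝ) * (a * a : ℕ) + (a * a : ℕ) := by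
    have h := Nat.lt_div_mul_add (a := N) (b := a * a) hd1
    exact_mod_cast h
  -- `a ≤ 4 log N/δ` from the trivial bound, hence `a² ≤ P²`
  have ha4 : (a : ℝ) ≤ 4 * Real.log N / δ := by
    have h1 : δ / (4 * Real.log N) * N / a ≤ N / (a * a : ℕ) :=
      habig.trans ((norm_afExpSum_moebius_le_self _ _).trans hN'le)
    rw [hdaa, div_le_div_iff₀ ha0 (by positivity)] at h1
    rw [le_div_iff₀ hδ]
    have h2 : δ / (4 * Real.log N) * a * (N * a) ≤ 1 * (N * a) := by
      have e : δ / (4 * Real.log N) * a * (N * a) = δ / (4 * Real.log N) * N * (a * a) := by ring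
      rw [e, one_mul]; exact h1
    have h3 : δ / (4 * Real.log N) * a ≤ 1 := le_of_mul_le_mul_right h2 (by positivity)
    rw [div_mul_eq_mul_div, div_le_one (by positivity)] at h3
    linarith
  have hdP2 : ((a * a : ℕ) : ℝ) ≤ P ^ 2 := by
    rw [hdaa, ← sq]
    refine pow_le_pow_left₀ ha0.le (ha4.trans ?_) 2
    calc 4 * Real.log N / δ ≤ 16 * Real.log N / δ := by
          rw [div_le_div_iff_of_pos_right hδ]; linarith only [hL0]
      _ ≤ P := hP16
  -- the density at scale `N/a²`
  have hδ'0 : 0 < δ / (4 * Real.log N) := by positivity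
  have hδ'1 : δ / (4 * Real.log N) ≤ 1 := by
    rw [div_le_one (by positivity)]; linarith only [hδ1, hL1]
  have hbig' : δ / (4 * Real.log N) * ((N / (a * a) : ℕ) : ℝ) ≤
      ‖afExpSum (⇑(μ : ArithmeticFunction ℝ)) (N / (a * a)) (θ * (a * a : ℕ))‖ := by
    refine le_trans ?_ habig
    calc δ / (4 * Real.log N) * ((N / (a * a) : ℕ) : ℝ)
        ≤ δ / (4 * Real.log N) * (N / (a * a : ℕ)) := mul_le_mul_of_nonneg_left hN'le hδ'0.le
      _ = δ / (4 * Real.log N) * N / a * (1 / a) := by rw [hdaa]; field_simp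
      _ ≤ δ / (4 * Real.log N) * N / a * 1 := by
          refine mul_le_mul_of_nonneg_left ?_ (by positivity)
          rw [div_le_one ha0]; exact ha1'
      _ = δ / (4 * Real.log N) * N / a := mul_one _
  -- Step 2: small `N/a²` is trivial
  by_cases hN'3 : N / (a * a) < 3
  · refine htriv ?_
    -- `N < 3a² ≤ 3P² ≤ P^50`
    have h1 : (N : ℝ) < 3 * (a * a : ℕ) := by
      have h2' : ((N / (a * a) : ℕ) : ℝ) ≤ 2 := by exact_mod_cast (by omega : N / (a * a) ≤ 2)
      have := mul_le_mul_of_nonneg_right h2' hd0.le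
      linarith only [this, hdN']
    have h2 : (3 : ℝ) * P ^ 2 ≤ P ^ 50 := by
      have : (3 : ℝ) ≤ P ^ 48 := le_trans (by linarith only [hP1, h16, hP16]) (le_self_pow₀ hP1 (by norm_num))
      calc (3 : ℝ) * P ^ 2 ≤ P ^ 48 * P ^ 2 := by gcongr
        _ = P ^ 50 := by ring
    have h3 : (3 : ℝ) * (a * a : ℕ) ≤ 3 * P ^ 2 := by linarith only [hdP2]
    linarith only [h1, h2, h3]
  push Not at hN'3
  -- Step 3: Proposition 4 for `μ` at scale `N/a²`, phase `a²θ`, density `δ/(4 log N)`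
  obtain ⟨q', hq'1, hq'le, b, -, happrox⟩ :=
    hμ (N / (a * a)) hN'3 (θ * (a * a : ℕ)) (δ / (4 * Real.log N)) hδ'0 hδ'1 hbig'
  have hN'0 : (0 : ℝ) < ((N / (a * a) : ℕ) : ℝ) := by exact_mod_cast (by omega : 0 < N / (a * a))
  have hlogN' : Real.log ((N / (a * a) : ℕ) : ℝ) ≤ Real.log N :=
    Real.log_le_log hN'0 (hN'le.trans (div_le_self hN0.le (by exact_mod_cast hd1)))
  have hlogN'1 : 1 ≤ Real.log ((N / (a * a) : ℕ) : ℝ) := one_le_log_of_three_le hN'3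
  generalize hPμ : Cμ * Real.log ((N / (a * a) : ℕ) : ℝ) ^ 4 / (δ / (4 * Real.log N)) = Pμ
    at hq'le happrox
  have hPμP : Pμ ≤ P ^ 2 := by
    -- `Cμ (log N')⁴ · 4 log N/δ ≤ 4 Cμ (log N)⁵/δ ≤ (16 Cμ (log N)⁴/δ)²`
    rw [← hPμ, ← hP, div_div_eq_mul_div, div_pow, div_le_div_iff₀ hδ (by positivity)]
    have hl4 : Real.log ((N / (a * a) : ℕ) : ℝ) ^ 4 ≤ Real.log N ^ 4 :=
      pow_le_pow_left₀ (by linarith) hlogN' 4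
    have hL5 : Real.log N ^ 5 ≤ Real.log N ^ 8 := pow_le_pow_right₀ hL1 (by norm_num)
    have hC : 4 * Cμ ≤ 256 * Cμ ^ 2 := by
      have := le_self_pow₀ hCμ1 two_ne_zero; linarith only [this, hCμ1]
    have hδ2 : δ ^ 2 ≤ δ := pow_le_of_le_one hδ.le hδ1 two_ne_zero
    have hA : 4 * Cμ * Real.log N ^ 5 ≤ 256 * Cμ ^ 2 * Real.log N ^ 8 :=
      mul_le_mul hC hL5 (by positivity) (by positivity)
    calc Cμ * Real.log ((N / (a * a) : ℕ) : ℝ) ^ 4 * (4 * Real.log N) * δ ^ 2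
        = (4 * Cμ * Real.log N * δ ^ 2) * Real.log ((N / (a * a) : ℕ) : ℝ) ^ 4 := by ring
      _ ≤ (4 * Cμ * Real.log N * δ ^ 2) * Real.log N ^ 4 :=
          mul_le_mul_of_nonneg_left hl4 (by positivity)
      _ = 4 * Cμ * Real.log N ^ 5 * δ ^ 2 := by ring
      _ ≤ 4 * Cμ * Real.log N ^ 5 * δ := mul_le_mul_of_nonneg_left hδ2 (by positivity)
      _ ≤ 256 * Cμ ^ 2 * Real.log N ^ 8 * δ := mul_le_mul_of_nonneg_right hA hδ.le
      _ = (16 * Cμ * Real.log N ^ 4) ^ 2 * δ := by ring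
  have hPμ0 : 0 ≤ Pμ := by rw [← hPμ]; positivity
  have hPμ20 : Pμ ^ 20 ≤ P ^ 40 := by
    calc Pμ ^ 20 ≤ (P ^ 2) ^ 20 := pow_le_pow_left₀ hPμ0 hPμP 20
      _ = P ^ 40 := by ring
  -- Step 4: the approximation `b/(q'a²)` of `θ`
  obtain ⟨q, hq1, hqle, c, hcop, herr⟩ := exists_reduced_approx hd1 hq'1 happrox
  have hNd2 : (N : ℝ) ≤ 2 * (((N / (a * a) : ℕ) : ℝ) * (a * a : ℕ)) := by
    have h3 : (3 : ℝ) ≤ ((N / (a * a) : ℕ) : ℝ) := by exact_mod_cast hN'3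
    have := mul_le_mul_of_nonneg_right h3 hd0.le
    linarith only [this, hdN']
  have herr' : |θ - c / q| ≤ 2 * P ^ 40 / N := by
    refine herr.trans ?_
    rw [div_div, div_le_div_iff₀ (by positivity) hN0]
    calc Pμ ^ 20 * N ≤ P ^ 40 * (2 * (((N / (a * a) : ℕ) : ℝ) * (a * a : ℕ))) :=
          mul_le_mul hPμ20 hNd2 hN0.le (by positivity)
      _ = 2 * P ^ 40 * (((N / (a * a) : ℕ) : ℝ) * (a * a : ℕ)) := by ring
  have hP2le : 2 * P ^ 40 ≤ P ^ 50 := by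
    have hP2 : (2 : ℝ) ≤ P ^ 10 :=
      le_trans (by linarith only [h16, hP16]) (le_self_pow₀ hP1 (by norm_num))
    calc 2 * P ^ 40 ≤ P ^ 10 * P ^ 40 := by gcongr
      _ = P ^ 50 := by ring
  refine ⟨q, hq1, ?_, c, hcop, herr'.trans (div_le_div_of_nonneg_right hP2le hN0.le)⟩
  -- `q ≤ q' a² ≤ P^40 · P² ≤ P^50`
  have hq'P : (q' : ℝ) ≤ P ^ 40 := hq'le.trans hPμ20
  calc (q : ℝ) ≤ (q' * (a * a) : ℕ) := by exact_mod_cast hqle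
    _ = (q' : ℝ) * (a * a : ℕ) := by push_cast; ring
    _ ≤ P ^ 40 * P ^ 2 := mul_le_mul hq'P hdP2 hd0.le (by positivity)
    _ = P ^ 42 := by ring
    _ ≤ P ^ 50 := pow_le_pow_right₀ hP1 (by norm_num)

end MoebiusExpSum

end Literature.NumberTheory.LFunctions
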